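import Literature.AnabelianGeometry.AbsoluteAnabelian.FundamentalExtensionRestriction
import Literature.AnabelianGeometry.AbsoluteAnabelian.AbsTopISemiAbsolute
import Literature.AnabelianGeometry.AbsoluteAnabelian.GaloisSubextensionProofs
import Literature.AnabelianGeometry.AbsoluteAnabelian.AbsTopIThm26iProSigmaProofs
import Literature.AnabelianGeometry.AbsoluteAnabelian.AbsTopIAlmostProSigmaBridge
import HarnessLib

/-!
# Descent of `Δ` topologically finitely generated / pro-`Σ` to the restriction `E.ofOpenSubgroup U`

abc-iut cell, layer L4, proof-only companion of the adapter «MLFBASE-OF-OPEN»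
(`FundamentalExtensionRestrictionMLFBase.lean`; L4-lead 2026-08-26T11:49:03Z: "the transport lemmas
every «apply (ii)/(iii)/(v) to an arbitrary open `H ⊆ Π`» step needs … `GeomTFG`/`IsProSet` descend
to `U`"; writer abc-iut-L4-t11, consumers abc-iut-w6-d034 / w6-d073 / w6-d027).  For the extension
`1 → Δ → Π → G → 1` and an open subgroup `U ⊆ Π`, the restricted extension
`E.ofOpenSubgroup U = (1 → Δ_U → U → aug(U) → 1)` of `FundamentalExtensionRestriction.lean` (A1) has
`Δ_U = Δ ∩ U` (`geom_ofOpenSubgroup`); here: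

* `nonempty_continuousMulEquiv_geom_ofOpenSubgroup` — `Δ_U ≅ Δ ∩ U` as topological groups
  (`Δ ∩ U ≤ Π` with the subspace topology), and `…_subgroupOf` — `Δ_U ≅ (Δ ∩ U viewed in Δ)`, an
  OPEN subgroup of `Δ` (`isOpen_geom_inf_subgroupOf`);
* `geomTFG_ofOpenSubgroup` — `Δ` topologically finitely generated ⇒ `Δ_U` is ([AbsTopI] §0 p. 8 /
  Prop 2.2: open subgroups of compact tfg groups are tfg, `IsTopologicallyFinitelyGenerated.subgroup_isOpen`);
* `isProSet_geom_ofOpenSubgroup` — `Δ` pro-`Σ` ⇒ `Δ_U` pro-`Σ` ([AbsTopI] Def 1.1 (iii);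
  `isProSet_geom_inf_of_isOpen`, `IsProSet.of_continuousMulEquiv`).

So the "for every open subgroup `Π′ ⊆ Π`" inputs of [AbsTopI] Thm 2.6 (the construction data `Δ`
tfg and pro-`Σ`, Def 2.1) are available BY NAME at `E.ofOpenSubgroup U`.  Proof-only (no
definitions); pure topological group theory; nothing here bears on the disputed [IUTchIII] Cor. 3.12.
-/

noncomputable section

open Topology

universe u

namespace Literature.AnabelianGeometry.AbsoluteAnabelian

namespace FundamentalExtension

variable (E : FundamentalExtension.{u}) (U : OpenSubgroup E.arith)

/-- **`Δ_U ≅ Δ ∩ U`** as topological groups: the geometric subgroup of `E.ofOpenSubgroup U` (a subgroup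
of `U`) and `Δ ∩ U ≤ Π`, both with the subspace topology of `Π`.
[cite: MochizukiAbsTopIII2015, Thm 1.9 p.38] -/
theorem nonempty_continuousMulEquiv_geom_ofOpenSubgroup :
    Nonempty ((E.ofOpenSubgroup U).geom ≃ₜ* ↥(E.geom ⊓ (U : Subgroup E.arith))) :=
  ⟨{ toFun := fun x => ⟨x.1.1, (E.mem_geom_ofOpenSubgroup_iff U x.1).1 x.2, x.1.2⟩
     invFun := fun y => ⟨⟨y.1, y.2.2⟩, (E.mem_geom_ofOpenSubgroup_iff U ⟨y.1, y.2.2⟩).2 y.2.1⟩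
     left_inv := fun _ => rfl
     right_inv := fun _ => rfl
     map_mul' := fun _ _ => rfl
     continuous_toFun :=
       Continuous.subtype_mk (continuous_subtype_val.comp continuous_subtype_val) _
     continuous_invFun :=
       Continuous.subtype_mk (Continuous.subtype_mk continuous_subtype_val _) _ }⟩

/-- `Δ ∩ U`, viewed inside `Δ`, is open in `Δ` (preimage of the open `U` under `Δ ↪ Π`).
[cite: MochizukiAbsTopI2012, §0 p.8] -/
theorem isOpen_geom_inf_subgroupOf :
    IsOpen (((E.geom ⊓ (U : Subgroup E.arith)).subgroupOf E.geom : Subgroup E.geom) : Set E.geom) := by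
  have hV : (((E.geom ⊓ (U : Subgroup E.arith)).subgroupOf E.geom : Subgroup E.geom) : Set E.geom) =
      Subtype.val ⁻¹' ((U : Subgroup E.arith) : Set E.arith) := by
    ext x
    simp only [SetLike.mem_coe, Subgroup.mem_subgroupOf, Subgroup.mem_inf, Set.mem_preimage]
    exact ⟨fun h => h.2, fun h => ⟨x.2, h⟩⟩
  rw [hV]
  exact U.isOpen.preimage continuous_subtype_val

/-- **`Δ_U ≅ (Δ ∩ U ≤ Δ)`** as topological groups — `Δ_U` is (isomorphic to) an OPEN subgroup of `Δ`.
[cite: MochizukiAbsTopI2012, §0 p.8] -/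
theorem nonempty_continuousMulEquiv_geom_ofOpenSubgroup_subgroupOf :
    Nonempty ((E.ofOpenSubgroup U).geom ≃ₜ* ↥((E.geom ⊓ (U : Subgroup E.arith)).subgroupOf E.geom)) := by
  obtain ⟨e⟩ := E.nonempty_continuousMulEquiv_geom_ofOpenSubgroup U
  let e₀ : ↥((E.geom ⊓ (U : Subgroup E.arith)).subgroupOf E.geom) ≃* ↥(E.geom ⊓ (U : Subgroup E.arith)) :=
    Subgroup.subgroupOfEquivOfLe inf_le_left
  let e' : ↥((E.geom ⊓ (U : Subgroup E.arith)).subgroupOf E.geom) ≃ₜ* ↥(E.geom ⊓ (U : Subgroup E.arith)) :=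
    { e₀ with
      continuous_toFun := by
        refine Continuous.subtype_mk ?_ _
        exact continuous_subtype_val.comp continuous_subtype_val
      continuous_invFun := by
        refine Continuous.subtype_mk (Continuous.subtype_mk continuous_subtype_val _) _ }
  exact ⟨e.trans e'.symm⟩

/-- **`Δ` tfg ⇒ `Δ_U` tfg** ([AbsTopI] Prop 2.2 for the covering: an open subgroup of the compact
topologically finitely generated group `Δ` is topologically finitely generated, §0 p. 8).
[cite: MochizukiAbsTopI2012, Prop 2.2 p.18] -/
theorem geomTFG_ofOpenSubgroup (hΔ : E.GeomTFG) : (E.ofOpenSubgroup U).GeomTFG := by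
  haveI : CompactSpace E.geom := isCompact_iff_compactSpace.mp E.isClosed_geom.isCompact
  obtain ⟨e⟩ := E.nonempty_continuousMulEquiv_geom_ofOpenSubgroup_subgroupOf U
  exact ((show IsTopologicallyFinitelyGenerated E.geom from hΔ).subgroup_isOpen _
    (E.isOpen_geom_inf_subgroupOf U)).of_continuousMulEquiv e.symm

/-- **`Δ` pro-`Σ` ⇒ `Δ_U` pro-`Σ`** ([AbsTopI] Def 1.1 (iii): `Δ ∩ U` is an open subgroup of the
pro-`Σ` group `Δ`). [cite: MochizukiAbsTopI2012, Def 1.1 (iii) p.10] -/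
theorem isProSet_geom_ofOpenSubgroup {S : Set ℕ} (hΔS : IsProSet E.geom S) :
    IsProSet (E.ofOpenSubgroup U).geom S := by
  obtain ⟨e⟩ := E.nonempty_continuousMulEquiv_geom_ofOpenSubgroup U
  exact (E.isProSet_geom_inf_of_isOpen hΔS (U : Subgroup E.arith) U.isOpen).of_continuousMulEquiv e.symm

/-- **`Δ` ALMOST pro-`Σ` ⇒ `Δ_U` ALMOST pro-`Σ`** — the honest Def 2.1 (i) datum ("an almost pro-`Σ`-maximal
quotient", [AbsTopI] Def 2.1 (i) p. 17) descends to the restricted extension: `Δ ∩ U` is open in `Δ`,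
and an open subgroup of an almost pro-`Σ` group is almost pro-`Σ` (`isAlmostPro_geom_inf_of_isOpen`,
`IsAlmostPro.of_continuousMulEquiv`).  (APPEND 2026-08-26, abc-iut-L4-t11: the cell's closers are now
keyed on `IsAlmostPro`, so this is the form the «for every open `Π′`» instances consume.)
[cite: MochizukiAbsTopI2012, Def 2.1 (i) p.17] -/
theorem isAlmostPro_geom_ofOpenSubgroup {S : Set ℕ} (hΔS : IsAlmostPro E.geom S) :
    IsAlmostPro (E.ofOpenSubgroup U).geom S := by
  obtain ⟨e⟩ := E.nonempty_continuousMulEquiv_geom_ofOpenSubgroup U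
  exact (E.isAlmostPro_geom_inf_of_isOpen hΔS (U : Subgroup E.arith) U.isOpen).of_continuousMulEquiv e.symm

/-- **Splitting over an open subgroup descends to `E.ofOpenSubgroup U`** ([AbsAnab] §1.1 p. 7 standing
hypothesis "splits over some open subgroup of `G`", the input of Lemma 1.1.4 (ii) / [AbsTopI] Thm 2.6
(ii) as typed): if `s : G₀ → Π` splits `aug` over an open `G₀ ⊆ G`, then over the open subgroup
`G₁ := {g ∈ G₀ | s g ∈ U}` of `aug(U)` (indeed `g = aug (s g) ∈ aug(U)`) the same `s` splits the
restricted augmentation `U ↠ aug(U)`.  (APPEND 2026-08-26, abc-iut-L4-t11.)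
[cite: MochizukiAbsAnab2004, Lemma 1.1.4 (ii) p.7] -/
theorem splitsOverOpenSubgroup_ofOpenSubgroup (h : E.SplitsOverOpenSubgroup) :
    (E.ofOpenSubgroup U).SplitsOverOpenSubgroup := by
  obtain ⟨G₀, s, hG₀, hs⟩ := h
  -- `K = s⁻¹(U) ≤ G₀`, open; its image `G₁′ ≤ G`, open and contained in `aug(U)`
  let K : Subgroup G₀ := (U : Subgroup E.arith).comap s.toMonoidHom
  have hKo : IsOpen (K : Set G₀) := U.isOpen.preimage s.continuous
  let G₁' : Subgroup E.gal := K.map G₀.subtype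
  have hG₁'o : IsOpen (G₁' : Set E.gal) := by
    have h1 : (G₁' : Set E.gal) = Subtype.val '' (K : Set G₀) := by
      rw [Subgroup.coe_map]; rfl
    rw [h1]
    exact hG₀.isOpenMap_subtype_val _ hKo
  have hmemG₀ : ∀ {g : E.gal}, g ∈ G₁' → g ∈ G₀ := by
    rintro g ⟨k, -, rfl⟩
    exact k.2
  have hmemU : ∀ {g : E.gal} (hg : g ∈ G₁'), s ⟨g, hmemG₀ hg⟩ ∈ (U : Subgroup E.arith) := by
    rintro g ⟨k, hk, rfl⟩
    exact hk
  -- `G₁ ≤ aug(U)`: the same set, seen inside `(E.ofOpenSubgroup U).gal = aug(U)`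
  let G₁ : Subgroup (E.ofOpenSubgroup U).gal := G₁'.comap (E.ofOpenSubgroupι U).gal.toMonoidHom
  have hG₁o : IsOpen (G₁ : Set (E.ofOpenSubgroup U).gal) :=
    hG₁'o.preimage (E.ofOpenSubgroupι U).gal.continuous
  have hmem₁ : ∀ γ : G₁, (γ.1.1 : E.gal) ∈ G₁' := fun γ => γ.2
  -- the section over `G₁`, valued in `U`
  let s₁ : G₁ →ₜ* (E.ofOpenSubgroup U).arith :=
    { toFun := fun γ => ⟨s ⟨γ.1.1, hmemG₀ (hmem₁ γ)⟩, hmemU (hmem₁ γ)⟩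
      map_one' := Subtype.ext (by
        change (s ⟨(1 : G₁).1.1, _⟩ : E.arith) = 1
        have : (⟨(1 : G₁).1.1, hmemG₀ (hmem₁ 1)⟩ : G₀) = 1 := Subtype.ext rfl
        rw [this, map_one])
      map_mul' := fun γ δ => Subtype.ext (by
        change (s ⟨(γ * δ).1.1, _⟩ : E.arith) = s ⟨γ.1.1, _⟩ * s ⟨δ.1.1, _⟩
        have : (⟨(γ * δ).1.1, hmemG₀ (hmem₁ (γ * δ))⟩ : G₀) =
            ⟨γ.1.1, hmemG₀ (hmem₁ γ)⟩ * ⟨δ.1.1, hmemG₀ (hmem₁ δ)⟩ := Subtype.ext rfl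
        rw [this, map_mul])
      continuous_toFun := by
        refine Continuous.subtype_mk ?_ _
        exact s.continuous.comp (Continuous.subtype_mk
          (continuous_subtype_val.comp continuous_subtype_val) _) }
  refine ⟨G₁, s₁, hG₁o, fun γ => Subtype.ext ?_⟩
  change E.aug (s ⟨γ.1.1, _⟩) = γ.1.1
  exact hs ⟨γ.1.1, hmemG₀ (hmem₁ γ)⟩

end FundamentalExtension

end Literature.AnabelianGeometry.AbsoluteAnabelian

end
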